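import Summits.ResolutionOfSingularities.ResolutionOfSingularities.Theorems.PAlterationPalterationThesisStubQuotientInduction
import HarnessLib

/-!
# Crux `PalterationThesis` (stmt-ResolutionOfSingularities-0552), line `Sketch` rev. c2:
# the residue `R1D` is stable under modifications of the regular base

Route `ResolutionOfSingularities/pAlteration`; helper file (`--supports stmt-0552`). The
registered Picover residue of the line over a perfect field `K` is `R1D_K`: for `B` regular and
`E ⊆ K(B)^{1/p}` of index `p` (via `β : E → K(B)`), the normalisation `B^E` has a resolution.
A prover attacking it by the programme of the card `multiplicative-residue-tame-destack` blows
`B` up in regular centres. This file records that this is free: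

* `hasResolution_normalizationIn_of_modification` — for `π : B' → B` proper and birational
  between integral schemes locally of finite type over a field and a finite extension `E` of
  `K(B)`, viewed over `K(B')` through the isomorphism `π^♯ : K(B) ≅ K(B')`, a resolution of
  `B'^E` yields one of `B^E` (`Picover.TowerTransport.hasResolution_normalizationIn_of_isProper`
  with the generic-fibre bookkeeping of a birational morphism);
* `r1D_datum_of_modification` — the `R1D` datum is preserved: `β' := π^♯ ∘ β` satisfies
  `β' ∘ (K(B') → E) = Frobenius` and `[K(B') : β'(E)] = [K(B) : β(E)]`.

So in `R1D_K` the regular `B` may be replaced by any regular modification `B' → B` (e.g. an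
iterated blow-up in regular centres) without changing `E`.
-/

set_option linter.dupNamespace false

noncomputable section

open CategoryTheory AlgebraicGeometry TopologicalSpace
open Literature.AlgebraicGeometry.Resolution Literature.AlgebraicGeometry.Motives

namespace Summit.ResolutionOfSingularities.ResolutionOfSingularities.Theorems.PalterationThesis.PerfectQuotient

/-- **Resolutions of `B^E` descend along modifications of `B`.** Let `π : B' → B` be proper and
birational between integral schemes, `B` locally of finite type over a field `k`, and `E` a
finite extension of `K(B)`; make `E` a `K(B')`-algebra through `(π^♯)⁻¹ : K(B') ≅ K(B)`. If
`B'^E` has a resolution then so has `B^E`. [folklore] -/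
theorem hasResolution_normalizationIn_of_modification {k : Type} [Field k] (B B' : Scheme.{0})
    [IsIntegral B] [IsIntegral B'] (f : B ⟶ Spec (.of k)) [LocallyOfFiniteType f]
    (π : B' ⟶ B) [IsProper π] (hπ : IsBirational π)
    (E : Type) [Field E] [Algebra B.functionField E] [FiniteDimensional B.functionField E]
    [Algebra B'.functionField E]
    (hcompat : haveI := hπ.isDominant;
      (algebraMap B'.functionField E).comp (RatFn.functionFieldMap π) = algebraMap B.functionField E)
    (hres : Scheme.HasResolution (normalizationIn B' E)) :
    Scheme.HasResolution (normalizationIn B E) := by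
  haveI : IsDominant π := hπ.isDominant
  have hbij : Function.Bijective (RatFn.functionFieldMap π) :=
    Picover.TowerTransport.bijective_functionFieldMap_of_isIso π hπ.isIso_stalkMap_genericPoint
  -- `E` is finite over `K(B')` (same image of the base field)
  haveI : FiniteDimensional B'.functionField E := by
    let e : B.functionField ≃+* B'.functionField := RingEquiv.ofBijective _ hbij
    have h : Module.finrank B'.functionField E = Module.finrank B.functionField E := by
      symm
      refine Algebra.finrank_eq_of_equiv_equiv e (RingEquiv.refl E) ?_
      rw [← hcompat]
      rfl
    exact Module.finite_of_finrank_pos (by rw [h]; exact Module.finrank_pos)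
  -- the fibre of `π` over the generic point is the generic point
  have hfib : ∀ b' : B', π b' = genericPoint B → b' = genericPoint B' := by
    intro b' hb'
    obtain ⟨U, hU, -, hUiso⟩ := hπ
    haveI := hUiso
    have hηU : genericPoint B ∈ U :=
      ((genericPoint_spec B).mem_open_set_iff U.isOpen).mpr (by simpa using hU.nonempty)
    exact Picover.TowerTransport.subsingleton_preimage_of_isIso_morphismRestrict π U hηU hb'
      (RatFn.genericPoint_eq_of_isDominant π)
  exact Picover.TowerTransport.hasResolution_normalizationIn_of_isProper
    Picover.FunctionFieldNormalizationIn.stub_functionField_normalizationIn B f E B' π hcompat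
    hfib hres

/-- **The `R1D` datum transported along a modification.** With `π : B' → B` proper birational,
`β : E → K(B)` with `β ∘ (K(B) → E) = Frobenius`, and `E` over `K(B')` through `(π^♯)⁻¹`, the
ring map `β' := π^♯ ∘ β : E → K(B')` again satisfies `β' ∘ (K(B') → E) = Frobenius`, and
`[K(B') : β'(E)] = [K(B) : β(E)]`. [folklore] -/
theorem r1D_datum_of_modification {p : ℕ} (B B' : Scheme.{0}) [IsIntegral B] [IsIntegral B']
    (π : B' ⟶ B) [IsDominant π] (hbij : Function.Bijective (RatFn.functionFieldMap π))
    (E : Type) [Field E] [Algebra B.functionField E] [Algebra B'.functionField E]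
    (hcompat : (algebraMap B'.functionField E).comp (RatFn.functionFieldMap π) =
      algebraMap B.functionField E)
    (β : E →+* B.functionField) (hβ : ∀ b : B.functionField, β (algebraMap B.functionField E b) = b ^ p) :
    (∀ b' : B'.functionField, ((RatFn.functionFieldMap π).comp β)
        (algebraMap B'.functionField E b') = b' ^ p) ∧
      Module.finrank ((RatFn.functionFieldMap π).comp β).fieldRange B'.functionField =
        Module.finrank β.fieldRange B.functionField := by
  let e : B.functionField ≃+* B'.functionField := RingEquiv.ofBijective _ hbij
  refine ⟨fun b' => ?_, ?_⟩
  · obtain ⟨b, rfl⟩ := hbij.2 b'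
    have h1 := RingHom.congr_fun hcompat b
    simp only [RingHom.coe_comp, Function.comp_apply] at h1 ⊢
    rw [h1, hβ, map_pow]
  · rw [finrank_fieldRange_eq, finrank_fieldRange_eq]
    letI a1 : Algebra E B'.functionField := ((RatFn.functionFieldMap π).comp β).toAlgebra
    letI a2 : Algebra E B.functionField := β.toAlgebra
    symm
    refine Algebra.finrank_eq_of_equiv_equiv (RingEquiv.refl E) e ?_
    ext x
    rfl

end Summit.ResolutionOfSingularities.ResolutionOfSingularities.Theorems.PalterationThesis.PerfectQuotient

end
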